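import Literature.NumberTheory.GaloisRepresentations.LubinTateColemanRelativeFunctorialTwo
import Literature.NumberTheory.GaloisRepresentations.LubinTateComparisonAddPoints
import HarnessLib

/-!
# `q = 2`: the product formula for the relative norm operator `𝒩_E` at points, and Galois equivariance
# of point evaluation of `𝒪_E`-series (de Shalit I §2.1 (1), (iii); §2.2 (2), relative situation)

De Shalit, *Iwasawa theory of elliptic curves with complex multiplication* (1987), Ch. I §2.1–2.2, in the
RELATIVE situation `k' ⊇ k` (here: a finite `E ⊇ F` inside `F̄`, later unramified) for the Lubin–Tate group
of `f = πX + X²` of `F` (`|𝓀_F| = 2`; `f` has coefficients in `𝒪_F ⊆ 𝒪_E`, so `φ(f) = f` and de Shalit's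
`𝒩_{φ^i f}` are all the one operator `𝒩_E` = `relNormTwo` of `LubinTateColemanRelativeTraceTwo`).  For a
series `G ∈ 𝒪_E⟦X⟧` and a point `y` of `𝔪_E` we write `G(y)` for `LubinTate.evS (maxNilIdeal F E) y G`.
Everything PROVED, 0 sorry:

* `prod_residueField_two` — `∏_{c ∈ 𝓀} φ c = φ 0 · φ 1` (`𝓀 = {0, 1}`).
* `evS_map_ltSer` — `f(y) = [π]_f y`; ★ `evS_ltSMul_pi_relNormTwo` — **`(𝒩_E G)([π] y) = G(y) · G(y [+] (−π))`**
  and `evS_ltSMul_pi_relNormTwo_eq_prod` — `= ∏_{c ∈ 𝓀} G(y [+] ω_c)` (de Shalit's (1) at points, `W_f^1 = {0, −π}`).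
* `inclPt_ltDivPt_two` — inside any finite `E ⊇ K_π^{m+1}` the division points `ω_c = [π^m c]λ_{m+1}` of
  `K_π^{m+1}` are the `F`-rational family `{0, −π}` (`divPtTwo`).
* ★★ `evS_ltSMul_pow_relNormTwo_iterate` — **de Shalit's (iii) at points, relative form**: for `E ⊇ K_π^{m+1}`,
  `k ≤ m + 1`, `G ∈ 𝒪_E⟦X⟧`, `y ∈ 𝔪_E`:
  `(𝒩_E^{(k)} G)([π^k] y) = ∏_{d ∈ 𝓀^k} G(y [+] [π^{m+1-k} Σ digit(dᵢ)πⁱ] λ_{m+1})` (the product over `y [+] W_f^k`).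
* `relNormTwo_iterate_map_inclUnitBall` — `𝒩_{E₂}^{(k)}(ιG) = ι(𝒩_{E₁}^{(k)} G)` along `E₁ ≤ E₂`;
  `relNormTwo_iterate_map` — `𝒩_E^{(k)}(G^ψ) = (𝒩_E^{(k)} G)^ψ` for `ψ` fixing `π`.
* ★ `algEquiv_evS` — **`σ(G(y)) = G^σ(σ y)`** for `σ ∈ Aut(E/F)`, and `algEquiv_evS_map_inclUnitBall` — for
  `G ∈ 𝒪_{E₁}⟦X⟧` and `σ ∈ Aut(E₂/F)` fixing `E₁` pointwise, **`σ(G^ι(y)) = G^ι(σ y)`** (de Shalit I §2.3 (iv), proof).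

These are the two inputs of the relative form of de Shalit's (2) — "the product over the stabiliser of
`[π^k]ω` in `Gal(E·K_π^{m+1}/E)` of `σ(G^ι(ω))` is `(𝒩_E^{(k)} G)^ι([π^k]ω)`" — proved in the sequel
`LubinTateColemanRelativeNormCoherentTwo` together with the parametrisation of that stabiliser.

## References

* E. de Shalit, *Iwasawa theory of elliptic curves with complex multiplication* (1987), Ch. I §2.1 Proposition
  (1), (iii); §2.2 (2); §2.3 (iv). [deShalit1987]
* R. Coleman, *Division values in local fields*, Invent. Math. 53 (1979), §§3–4.

## Mathlib / tree reuse

`MvPowerSeries.comp_eval₂`, `MvPowerSeries.eval₂_unique`, `Finset.prod_insert`, `Fin.snocEquiv`,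
`Fintype.prod_equiv`; tree: `LubinTate.evS_subst`, `LubinTate.evS_evT`, `LubinTate.evSPt_tPt`, `subst_relNormTwo`,
`reflE_apply`, `coe_ltSMul_pi_two`, `map_ltSer_eq`, `divPtTwo`, `coe_ltDivPt_of_ne_zero_two`, `inclUnitBall_ltSMul`,
`relNormTwo_map_inclUnitBall`, `map_relNormTwo`, `digitSum_snoc`, `digitSum_fin_zero`.
-/

noncomputable section

open scoped PowerSeries.WithPiTopology

namespace Literature.NumberTheory.GaloisRepresentations

section RelativeProductTwo

open GaloisRepresentations.IsNonarchimedeanLocalField LubinTate ValuativeRel Field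

variable (F : Type*) [Field F] [ValuativeRel F] [TopologicalSpace F] [IsNonarchimedeanLocalField F]

attribute [local instance] ltNormUniformSpace ltNormIsUniformAddGroup rk1 nF nE fintypeResidueField

variable {F}
variable {π : 𝒪[F]} (hπ : (valuation F).IsUniformizer (π : F))

/-! ### `𝓀 = {0, 1}` -/

omit hπ in
/-- At `q = 2` the residue field is `{0, 1}`: `∏_{c ∈ 𝓀} φ c = φ 0 · φ 1`. [cite: deShalit1987, Ch. I §1.7] -/
theorem prod_residueField_two {M : Type*} [CommMonoid M] (hq : residueFieldCard F = 2) (φ : 𝓀[F] → M) :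
    ∏ c : 𝓀[F], φ c = φ 0 * φ 1 := by
  classical
  have huniv : (Finset.univ : Finset 𝓀[F]) = {0, 1} := by
    ext c
    simp only [Finset.mem_univ, Finset.mem_insert, Finset.mem_singleton, true_iff]
    exact eq_zero_or_eq_one_two hq c
  rw [huniv, Finset.prod_insert (by simp), Finset.prod_singleton]

variable (E : IntermediateField F (AlgebraicClosure F)) [FiniteDimensional F E]

/-! ### The one-step product formula `(𝒩_E G)([π] y) = G(y) · G(y [+] (−π))` -/

/-- **`f(y) = [π]_f y`** for a point `y` of `𝔪_E` (`f = πX + X²` read in `𝒪_E⟦X⟧`, evaluated with `evS`).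
[cite: deShalit1987, Ch. I §1.7] -/
theorem evS_map_ltSer (hq : residueFieldCard F = 2) (y : (maxNilIdeal F E).toIdeal) :
    evS (maxNilIdeal F E) y ((ltSer F π).map (algebraMap (LTCoeff F) (unitBall E))) =
      ((ltSMul (maxNilIdeal F E) (isLTRing_LTCoeff hπ) (isLTSeries_LTCoeff π) (LTCoeff.of F π) y :
        (maxNilIdeal F E).toIdeal) : unitBall E) := by
  apply Subtype.ext
  rw [coe_ltSMul_pi_two hπ E hq, map_ltSer_eq E, hq, map_add, map_mul, map_pow, evS_C, evS_X]
  rw [Subring.coe_add, Subring.coe_mul, SubmonoidClass.coe_pow, algebraMap_integer_apply]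
  ring

/-- The point `f(y) = [π] y` packaged: the `evS`-value of `f` at `y`, as a point, is `[π] y`.
[cite: deShalit1987, Ch. I §1.7] -/
theorem evS_map_ltSer_pt (hq : residueFieldCard F = 2) (y : (maxNilIdeal F E).toIdeal) :
    (⟨evS (maxNilIdeal F E) y ((ltSer F π).map (algebraMap (LTCoeff F) (unitBall E))),
        evS_mem_of_constantCoeff_eq_zero (maxNilIdeal F E) y
          ((isLTSeries_ltSer π).map _).constantCoeff_eq_zero⟩ : (maxNilIdeal F E).toIdeal) =
      ltSMul (maxNilIdeal F E) (isLTRing_LTCoeff hπ) (isLTSeries_LTCoeff π) (LTCoeff.of F π) y :=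
  Subtype.ext (evS_map_ltSer hπ E hq y)

/-- **`(τ_E G)(y) = G(y [+] (−π))`**: the value of the reflection `G(−π − X)` at `y`.
[cite: deShalit1987, Ch. I §2.1 (1)] -/
theorem evS_reflE (y : (maxNilIdeal F E).toIdeal) (G : PowerSeries (unitBall E)) :
    evS (maxNilIdeal F E) y (reflE hπ E G) =
      evS (maxNilIdeal F E) (ltAdd (maxNilIdeal F E) (isLTRing_LTCoeff hπ) (isLTSeries_LTCoeff π) y
        (divPtTwo hπ E 1)) G := by
  rw [reflE_apply, evS_evT, evSPt_tPt]

/-- ★ **De Shalit's (1) at points, `q = 2`: `(𝒩_E G)([π] y) = G(y) · G(y [+] (−π))`** for `G ∈ 𝒪_E⟦X⟧` and a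
point `y` of `𝔪_E` (evaluate `(𝒩_E G) ∘ f = G · G(−π − X)` at `y`). [cite: deShalit1987, Ch. I §2.1 (1)] -/
theorem evS_ltSMul_pi_relNormTwo (hq : residueFieldCard F = 2) (G : PowerSeries (unitBall E))
    (y : (maxNilIdeal F E).toIdeal) :
    evS (maxNilIdeal F E) (ltSMul (maxNilIdeal F E) (isLTRing_LTCoeff hπ) (isLTSeries_LTCoeff π)
        (LTCoeff.of F π) y) (relNormTwo hπ E hq G) =
      evS (maxNilIdeal F E) y G *
        evS (maxNilIdeal F E) (ltAdd (maxNilIdeal F E) (isLTRing_LTCoeff hπ) (isLTSeries_LTCoeff π) y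
          (divPtTwo hπ E 1)) G := by
  have e := congrArg (evS (maxNilIdeal F E) y) (subst_relNormTwo hπ E hq G)
  rw [evS_subst (maxNilIdeal F E) y ((isLTSeries_ltSer π).map _).constantCoeff_eq_zero, evS_map_ltSer_pt hπ E hq,
    map_mul, evS_reflE] at e
  exact e

/-- **`(𝒩_E G)([π] y) = ∏_{c ∈ 𝓀} G(y [+] ω_c)`** with the `F`-rational family `ω_0 = 0`, `ω_1 = −π` (`divPtTwo`).
[cite: deShalit1987, Ch. I §2.1 (1)] -/
theorem evS_ltSMul_pi_relNormTwo_eq_prod (hq : residueFieldCard F = 2) (G : PowerSeries (unitBall E))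
    (y : (maxNilIdeal F E).toIdeal) :
    evS (maxNilIdeal F E) (ltSMul (maxNilIdeal F E) (isLTRing_LTCoeff hπ) (isLTSeries_LTCoeff π)
        (LTCoeff.of F π) y) (relNormTwo hπ E hq G) =
      ∏ c : 𝓀[F], evS (maxNilIdeal F E) (ltAdd (maxNilIdeal F E) (isLTRing_LTCoeff hπ) (isLTSeries_LTCoeff π) y
        (divPtTwo hπ E c)) G := by
  rw [prod_residueField_two hq, divPtTwo_zero, ltAdd_zero, evS_ltSMul_pi_relNormTwo hπ E hq]

/-! ### The division points of `K_π^{m+1}` inside `E ⊇ K_π^{m+1}` -/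

variable {E}

/-- `ι([a] x) = [a](ι x)` for a point `x` of `𝔪_{K_π^{m+1}}` and `K_π^{m+1} ≤ E` (point form of the tree's
`inclUnitBall_ltSMul`). [cite: CasselsFrohlichANT1967, Ch. VI §3.4] -/
theorem inclPt_ltAct_eq_ltSMul {m : ℕ} (hle : ltField π m ≤ E) (a : 𝒪[F])
    (x : (maxNilIdeal F (ltField π m)).toIdeal) :
    inclPt hle (ltAct hπ m a x) =
      ltSMul (maxNilIdeal F E) (isLTRing_LTCoeff hπ) (isLTSeries_LTCoeff π) (LTCoeff.of F a) (inclPt hle x) :=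
  Subtype.ext (inclUnitBall_ltSMul hle (LTCoeff.of F a) x)

/-- `ι(x [+] y) = ι x [+] ι y` (the inclusion `𝒪_{E₁} → 𝒪_{E₂}` is a continuous `𝒪_F`-algebra map).
[cite: CasselsFrohlichANT1967, Ch. VI §3.4] -/
theorem inclPt_ltAdd {E₁ E₂ : IntermediateField F (AlgebraicClosure F)} [FiniteDimensional F E₁]
    [FiniteDimensional F E₂] (h : E₁ ≤ E₂) (x y : (maxNilIdeal F E₁).toIdeal) :
    inclPt h (ltAdd (maxNilIdeal F E₁) (isLTRing_LTCoeff hπ) (isLTSeries_LTCoeff π) x y) =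
      ltAdd (maxNilIdeal F E₂) (isLTRing_LTCoeff hπ) (isLTSeries_LTCoeff π) (inclPt h x) (inclPt h y) := by
  apply Subtype.ext
  change inclUnitBall h _ = _
  rw [ltAdd, ltAdd, addPt, addPt, coe_evalPt, coe_evalPt, ← AlgHom.comp_apply,
    MvPowerSeries.comp_aeval _ (continuous_inclUnitBall h)]
  refine aeval_congr_family _ _ (funext fun i => ?_) _
  fin_cases i <;> rfl

/-- `ι 0 = 0` (the inclusion of points is additive). [cite: CasselsFrohlichANT1967, Ch. VI §3.4] -/
theorem inclPt_zero {E₁ E₂ : IntermediateField F (AlgebraicClosure F)} [FiniteDimensional F E₁]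
    [FiniteDimensional F E₂] (h : E₁ ≤ E₂) : inclPt h (0 : (maxNilIdeal F E₁).toIdeal) = 0 :=
  Subtype.ext (map_zero (inclUnitBall (F := F) h))

/-- ★ **Inside `E ⊇ K_π^{m+1}` the `π`-division points `ω_c = [π^m · digit c] λ_{m+1}` are the `F`-rational family
`{0, −π}`** (`q = 2`). [cite: deShalit1987, Ch. I §1.7] -/
theorem inclPt_ltDivPt_two (hq : residueFieldCard F = 2) {m : ℕ} (hle : ltField π m ≤ E) (c : 𝓀[F]) :
    inclPt hle (ltDivPt hπ m c) = divPtTwo hπ E c := by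
  rcases eq_zero_or_eq_one_two hq c with rfl | rfl
  · rw [ltDivPt_zero, divPtTwo_zero, inclPt_zero]
  · apply Subtype.ext; apply Subtype.ext
    change (IntermediateField.inclusion hle (((ltDivPt hπ m 1 : (maxNilIdeal F (ltField π m)).toIdeal) :
      unitBall (ltField π m)) : ltField π m) : E) = (((divPtTwo hπ E 1 : (maxNilIdeal F E).toIdeal) : unitBall E) : E)
    rw [coe_ltDivPt_one_two hπ m hq, coe_divPtTwo_of_ne_zero hπ E one_ne_zero, Subring.coe_neg, Subring.coe_neg,
      map_neg, algebraMap_integer_apply, algebraMap_integer_apply, AlgHom.commutes]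

/-! ### De Shalit's (iii) at points: `(𝒩_E^{(k)} G)([π^k] y) = ∏_{α ∈ W_f^k} G(y [+] α)` -/

/-- ★★ **The product formula for the iterates of `𝒩_E`, `q = 2`** (de Shalit I §2.1 (iii) at points, relative form):
for a finite `E ⊇ K_π^{m+1}`, `k ≤ m + 1`, `G ∈ 𝒪_E⟦X⟧` and a point `y` of `𝔪_E`,
`(𝒩_E^{(k)} G)([π^k] y) = ∏_{d ∈ 𝓀^k} G(y [+] [π^{m+1-k} Σᵢ digit(dᵢ) πⁱ] λ_{m+1})`, the product over the translates of `y`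
by the division points of level `k` (all inside `E`). [cite: deShalit1987, Ch. I §2.1 Proposition (iii)] -/
theorem evS_ltSMul_pow_relNormTwo_iterate (hq : residueFieldCard F = 2) {m : ℕ} (hle : ltField π m ≤ E) (k : ℕ)
    (hk : k ≤ m + 1) (G : PowerSeries (unitBall E)) (y : (maxNilIdeal F E).toIdeal) :
    evS (maxNilIdeal F E) (ltSMul (maxNilIdeal F E) (isLTRing_LTCoeff hπ) (isLTSeries_LTCoeff π)
        (LTCoeff.of F π ^ k) y) ((relNormTwo hπ E hq)^[k] G) =
      ∏ d : Fin k → 𝓀[F], evS (maxNilIdeal F E)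
        (ltAdd (maxNilIdeal F E) (isLTRing_LTCoeff hπ) (isLTSeries_LTCoeff π) y
          (inclPt hle (ltAct hπ m (π ^ (m + 1 - k) * digitSum (π := π) (residueDigit F) d) (genPt hπ m)))) G := by
  induction k generalizing G y with
  | zero =>
    rw [pow_zero, one_ltSMul, Function.iterate_zero_apply, Fintype.prod_unique, digitSum_fin_zero, mul_zero]
    have h0 : ltAct hπ m 0 (genPt hπ m) = 0 := by rw [ltAct, map_zero]; exact zero_ltSMul _ _ _ _
    rw [h0, inclPt_zero, ltAdd_zero]
  | succ k ih =>
    have hkm : k ≤ m := by omega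
    rw [Function.iterate_succ_apply, pow_succ, mul_ltSMul, ih (by omega)]
    -- each factor: `(𝒩G)([π]y [+] [π^{m+1-k} D]λ) = (𝒩G)([π](y [+] [π^{m-k} D]λ)) = ∏_c G(y [+] [π^{m-k}D]λ [+] ω_c)`
    have step : ∀ d : Fin k → 𝓀[F],
        evS (maxNilIdeal F E)
          (ltAdd (maxNilIdeal F E) (isLTRing_LTCoeff hπ) (isLTSeries_LTCoeff π)
            (ltSMul (maxNilIdeal F E) (isLTRing_LTCoeff hπ) (isLTSeries_LTCoeff π) (LTCoeff.of F π) y)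
            (inclPt hle (ltAct hπ m (π ^ (m + 1 - k) * digitSum (π := π) (residueDigit F) d) (genPt hπ m))))
          (relNormTwo hπ E hq G) =
        ∏ c : 𝓀[F], evS (maxNilIdeal F E)
          (ltAdd (maxNilIdeal F E) (isLTRing_LTCoeff hπ) (isLTSeries_LTCoeff π) y
            (inclPt hle (ltAct hπ m (π ^ (m + 1 - (k + 1)) *
              digitSum (π := π) (residueDigit F) (Fin.snoc d c : Fin (k + 1) → 𝓀[F])) (genPt hπ m)))) G := by
      intro d
      have e1 : π ^ (m + 1 - k) * digitSum (π := π) (residueDigit F) d =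
          π * (π ^ (m - k) * digitSum (π := π) (residueDigit F) d) := by
        rw [← mul_assoc, ← pow_succ', show m - k + 1 = m + 1 - k by omega]
      rw [e1, ltAct_mul, inclPt_ltAct_eq_ltSMul hπ hle π, ← ltSMul_ltAdd, evS_ltSMul_pi_relNormTwo_eq_prod hπ E hq]
      refine Finset.prod_congr rfl fun c _ => ?_
      have e2 : π ^ (m - k) * digitSum (π := π) (residueDigit F) d + π ^ m * residueDigit F c =
          π ^ (m + 1 - (k + 1)) * digitSum (π := π) (residueDigit F) (Fin.snoc d c : Fin (k + 1) → 𝓀[F]) := by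
        rw [digitSum_snoc, show m + 1 - (k + 1) = m - k by omega]
        obtain ⟨j, hj⟩ : ∃ j, m = j + k := ⟨m - k, by omega⟩
        rw [show m - k = j by omega, hj, pow_add]
        ring
      rw [ltAdd_assoc, ← inclPt_ltDivPt_two hπ hq hle, ← inclPt_ltAdd hπ hle, ltDivPt, ltAct, ltAct,
        ← add_ltSMul, ← map_add, e2]
    simp_rw [step]
    -- regroup `∏_d ∏_c` as a product over `𝓀^{k+1}` via `Fin.snoc`
    rw [Finset.prod_comm, ← Fintype.prod_prod_type' (f := fun c d => _)]
    exact Fintype.prod_equiv (Fin.snocEquiv fun _ => 𝓀[F]) _ _ (fun p => rfl)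

/-! ### Functoriality of the iterates -/

/-- **`𝒩_{E₂}^{(k)} (ι G) = ι (𝒩_{E₁}^{(k)} G)`** along `E₁ ≤ E₂`. [cite: deShalit1987, Ch. I §2.1] -/
theorem relNormTwo_iterate_map_inclUnitBall (hq : residueFieldCard F = 2)
    {E₁ E₂ : IntermediateField F (AlgebraicClosure F)} [FiniteDimensional F E₁] [FiniteDimensional F E₂]
    (h : E₁ ≤ E₂) (k : ℕ) (G : PowerSeries (unitBall E₁)) :
    (relNormTwo hπ E₂ hq)^[k] (PowerSeries.map (inclUnitBall (F := F) h : unitBall E₁ →+* unitBall E₂) G) =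
      PowerSeries.map (inclUnitBall (F := F) h : unitBall E₁ →+* unitBall E₂) ((relNormTwo hπ E₁ hq)^[k] G) := by
  induction k generalizing G with
  | zero => rfl
  | succ k ih => rw [Function.iterate_succ_apply, Function.iterate_succ_apply, relNormTwo_map_inclUnitBall hπ hq h, ih]

/-- **`𝒩_E^{(k)} (G^ψ) = (𝒩_E^{(k)} G)^ψ`** for a ring endomorphism `ψ` of `𝒪_E` fixing `π` (e.g. the Frobenius).
[cite: deShalit1987, Ch. I §2.1 Proposition (ii)] -/
theorem relNormTwo_iterate_map (hq : residueFieldCard F = 2) {ψ : unitBall E →+* unitBall E}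
    (hψ : ψ (algebraMap 𝒪[F] (unitBall E) π) = algebraMap 𝒪[F] (unitBall E) π) (k : ℕ)
    (G : PowerSeries (unitBall E)) :
    (relNormTwo hπ E hq)^[k] (PowerSeries.map ψ G) = PowerSeries.map ψ ((relNormTwo hπ E hq)^[k] G) := by
  induction k generalizing G with
  | zero => rfl
  | succ k ih => rw [Function.iterate_succ_apply, Function.iterate_succ_apply, ← map_relNormTwo hπ E hq hψ, ih]

/-- `𝒩_E^{(k)}` is multiplicative. [cite: deShalit1987, Ch. I §2.1] -/
theorem relNormTwo_iterate_mul (hq : residueFieldCard F = 2) (k : ℕ) (G H : PowerSeries (unitBall E)) :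
    (relNormTwo hπ E hq)^[k] (G * H) = (relNormTwo hπ E hq)^[k] G * (relNormTwo hπ E hq)^[k] H := by
  induction k generalizing G H with
  | zero => rfl
  | succ k ih => rw [Function.iterate_succ_apply, Function.iterate_succ_apply, Function.iterate_succ_apply,
      relNormTwo_mul, ih]

/-- `𝒩_E^{(k)} 1 = 1`. [cite: deShalit1987, Ch. I §2.1] -/
theorem relNormTwo_iterate_one (hq : residueFieldCard F = 2) (k : ℕ) : (relNormTwo hπ E hq)^[k] 1 = 1 := by
  induction k with
  | zero => rfl
  | succ k ih => rw [Function.iterate_succ_apply, relNormTwo_one, ih]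

/-! ### Galois equivariance of point evaluation -/

end RelativeProductTwo

namespace LubinTate

section MapEvS

variable {S : Type*} [CommRing S] [UniformSpace S] [IsUniformAddGroup S] [IsTopologicalRing S]
  [IsLinearTopology S S] [T2Space S] [CompleteSpace S]
variable {S' : Type*} [CommRing S'] [UniformSpace S'] [IsUniformAddGroup S'] [IsTopologicalRing S']
  [IsLinearTopology S' S'] [T2Space S'] [CompleteSpace S']
variable (M : NilIdeal S) (M' : NilIdeal S')

/-- ★ **`ψ(G(y)) = (ψG)(ψ y)`**: a continuous ring map carries evaluation of `S`-series at points of `M` to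
evaluation of `S'`-series at points of `M'` (both are sums `Σ G_d y^d`). [cite: CasselsFrohlichANT1967, Ch. VI §3.2] -/
theorem map_evS (ψ : S →+* S') (hψ : Continuous ψ) (y : M.toIdeal) (hy : ψ (y : S) ∈ M'.toIdeal)
    (G : PowerSeries S) :
    ψ (evS M y G) = evS M' ⟨ψ (y : S), hy⟩ (PowerSeries.map ψ G) := by
  have h1 := (PowerSeries.hasSum_aeval (M.isTopologicallyNilpotent _ y.2) G).map ψ hψ
  have h2 := PowerSeries.hasSum_aeval (M'.isTopologicallyNilpotent _ hy) (PowerSeries.map ψ G)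
  have hfun : (⇑ψ ∘ fun d : ℕ => PowerSeries.coeff d G • (y : S) ^ d) =
      fun d : ℕ => PowerSeries.coeff d (PowerSeries.map ψ G) • (ψ (y : S)) ^ d := by
    funext d
    simp only [Function.comp_apply, PowerSeries.coeff_map, smul_eq_mul, map_mul, map_pow]
  rw [hfun] at h1
  exact h1.unique h2

end MapEvS

end LubinTate

section RelativeGaloisEvS

open GaloisRepresentations.IsNonarchimedeanLocalField LubinTate ValuativeRel Field

variable {F : Type*} [Field F] [ValuativeRel F] [TopologicalSpace F] [IsNonarchimedeanLocalField F]

attribute [local instance] ltNormUniformSpace ltNormIsUniformAddGroup rk1 nF nE fintypeResidueField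

variable (E : IntermediateField F (AlgebraicClosure F)) [FiniteDimensional F E]

/-- ★ **`σ(G(y)) = G^σ(σ y)`** for `σ ∈ Aut(E/F)`, `G ∈ 𝒪_E⟦X⟧` and a point `y` of `𝔪_E` (`σ` is a continuous ring
automorphism of `𝒪_E`). [cite: deShalit1987, Ch. I §2.3 (iv) (proof)] -/
theorem algEquiv_evS (σ : E ≃ₐ[F] E) (G : PowerSeries (unitBall E)) (y : (maxNilIdeal F E).toIdeal) :
    toUnitBallHom σ (evS (maxNilIdeal F E) y G) =
      evS (maxNilIdeal F E) (mapPt σ y) (PowerSeries.map (toUnitBallHom σ : unitBall E →+* unitBall E) G) :=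
  map_evS (maxNilIdeal F E) (maxNilIdeal F E) (toUnitBallHom σ : unitBall E →+* unitBall E)
    (continuous_toUnitBallHom σ) y (mapPt σ y).2 G

variable {E} in
/-- **`σ(G^ι(y)) = G^ι(σ y)` for `σ` fixing the coefficient field**: `G ∈ 𝒪_{E₁}⟦X⟧`, `E₁ ≤ E₂`, `σ ∈ Aut(E₂/F)` with
`σ|_{E₁} = id`. [cite: deShalit1987, Ch. I §2.3 (iv) (proof)] -/
theorem algEquiv_evS_map_inclUnitBall {E₁ E₂ : IntermediateField F (AlgebraicClosure F)} [FiniteDimensional F E₁]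
    [FiniteDimensional F E₂] (h : E₁ ≤ E₂) (σ : E₂ ≃ₐ[F] E₂)
    (hσ : ∀ x : E₁, σ (IntermediateField.inclusion h x) = IntermediateField.inclusion h x)
    (G : PowerSeries (unitBall E₁)) (y : (maxNilIdeal F E₂).toIdeal) :
    σ ((evS (maxNilIdeal F E₂) y (PowerSeries.map (inclUnitBall (F := F) h : unitBall E₁ →+* unitBall E₂) G) :
        unitBall E₂) : E₂) =
      ((evS (maxNilIdeal F E₂) (mapPt σ y)
        (PowerSeries.map (inclUnitBall (F := F) h : unitBall E₁ →+* unitBall E₂) G) : unitBall E₂) : E₂) := by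
  have hfix : PowerSeries.map (toUnitBallHom σ : unitBall E₂ →+* unitBall E₂)
      (PowerSeries.map (inclUnitBall (F := F) h : unitBall E₁ →+* unitBall E₂) G) =
      PowerSeries.map (inclUnitBall (F := F) h : unitBall E₁ →+* unitBall E₂) G := by
    refine PowerSeries.ext fun n => ?_
    rw [PowerSeries.coeff_map, PowerSeries.coeff_map]
    exact Subtype.ext (hσ _)
  rw [← coe_toUnitBallHom σ, algEquiv_evS E₂ σ, hfix]

end RelativeGaloisEvS


end Literature.NumberTheory.GaloisRepresentations
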